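import Literature.Analysis.FluidPDE.ElgindiL12Corrector
import Literature.Analysis.FluidPDE.ElgindiLinearSolvability
import HarnessLib

/-!
# Theorem 2 of Elgindi (removing `L₁₂`) at `𝓗⁴` for smooth data supported in the open strip
([Elgindi2021] §7.5 Theorem 2)

Topic `Literature/Analysis/FluidPDE`. Support file (definitions with bodies and proved theorems, no
named facts) on the proof path of the named fact
`Literature.Analysis.FluidPDE.Elgindi.ElgindiGhoulMasmoudi2021_stabilityCore`
(`ElgindiStabilityDecomposition.lean`). T. M. Elgindi, Ann. of Math. 194 (2021) =
arXiv:1904.04795, §7.5 Theorem 2 (p. 24).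

For `0 < α ≤ 1/4` and `F ∈ C_c^∞(strip)` (no orthogonality to `K`): the modified datum
`F̂ = F − (5/4)(K,F)_θ·sin 2θ·κ(θ)` is orthogonal to `K`; `Ψ̂ = L⁻¹F̂` is the solution of
`ElgindiLinearSolvability.lean`; `Ψ = Ψ̂ − G ⊗ sin 2θ` with the corrector `G = G⋆ + Ḡ` solves
`LΨ = F` on the strip (`solution_eq`), and `Ψ − (4α)⁻¹L₁₂(F) sin 2θ = Ψ̂ − Ḡ ⊗ sin 2θ`.
-/

noncomputable section

open MeasureTheory Set Real Filter Function Finset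
open _root_.Topology
open scoped ENNReal InnerProductSpace ContDiff

namespace Literature.Analysis.FluidPDE

namespace Elgindi

/-! ### Linearity of `L` on strip-smooth functions -/

/-- **`L(f − g) = Lf − Lg` on the strip** for `f, g ∈ C^∞(strip)`. [folklore] -/
theorem ellipticOp_sub_strip (α : ℝ) {f g : ℝ → ℝ → ℝ} (hf : ContDiffOn ℝ ∞ (uncurry f) strip) (hg : ContDiffOn ℝ ∞ (uncurry g) strip)
    {p : ℝ × ℝ} (hp : p ∈ strip) :
    ellipticOp α (fun R θ => f R θ - g R θ) p.1 p.2 = ellipticOp α f p.1 p.2 - ellipticOp α g p.1 p.2 := by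
  -- first derivatives on the whole strip
  have hdz : ∀ q ∈ strip, dz (fun R θ => f R θ - g R θ) q.1 q.2 = dz f q.1 q.2 - dz g q.1 q.2 := by
    intro q hq
    have h1 := hasDerivAt_radial_slice (contDiffOn_nat_of_infty hf 1) hq.2 hq.1
    have h2 := hasDerivAt_radial_slice (contDiffOn_nat_of_infty hg 1) hq.2 hq.1
    exact (h1.sub h2).deriv
  have hdθ : ∀ q ∈ strip, dθ (fun R θ => f R θ - g R θ) q.1 q.2 = dθ f q.1 q.2 - dθ g q.1 q.2 := by
    intro q hq
    have h1 := TangentialFamily.hasDerivAt_slice_strip hf hq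
    have h2 := TangentialFamily.hasDerivAt_slice_strip hg hq
    exact (h1.sub h2).deriv
  -- second derivatives at `p`
  have hdzdz : dz (dz fun R θ => f R θ - g R θ) p.1 p.2 = dz (dz f) p.1 p.2 - dz (dz g) p.1 p.2 := by
    rw [eqOn_dz isOpen_strip (g := fun R θ => dz f R θ - dz g R θ) hdz hp]
    have h1 := hasDerivAt_radial_slice (contDiffOn_nat_of_infty (contDiffOn_dz_strip hf) 1) hp.2 hp.1
    have h2 := hasDerivAt_radial_slice (contDiffOn_nat_of_infty (contDiffOn_dz_strip hg) 1) hp.2 hp.1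
    exact (h1.sub h2).deriv
  have hdθdθ : dθ (dθ fun R θ => f R θ - g R θ) p.1 p.2 = dθ (dθ f) p.1 p.2 - dθ (dθ g) p.1 p.2 := by
    rw [eqOn_dθ isOpen_strip (g := fun R θ => dθ f R θ - dθ g R θ) hdθ hp]
    have h1 := TangentialFamily.hasDerivAt_slice_strip (contDiffOn_dθ_strip hf) hp
    have h2 := TangentialFamily.hasDerivAt_slice_strip (contDiffOn_dθ_strip hg) hp
    exact (h1.sub h2).deriv
  have htan : dθ (fun R θ => Real.tan θ * (f R θ - g R θ)) p.1 p.2 =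
      dθ (fun R θ => Real.tan θ * f R θ) p.1 p.2 - dθ (fun R θ => Real.tan θ * g R θ) p.1 p.2 := by
    have hc : Real.cos p.2 ≠ 0 := (Real.cos_pos_of_mem_Ioo ⟨by linarith [hp.2.1, Real.pi_pos], hp.2.2⟩).ne'
    have ht := Real.hasDerivAt_tan hc
    have h1 : HasDerivAt (fun θ => Real.tan θ * f p.1 θ) (1 / Real.cos p.2 ^ 2 * f p.1 p.2 + Real.tan p.2 * dθ f p.1 p.2) p.2 :=
      ht.mul (TangentialFamily.hasDerivAt_slice_strip hf hp)
    have h2 : HasDerivAt (fun θ => Real.tan θ * g p.1 θ) (1 / Real.cos p.2 ^ 2 * g p.1 p.2 + Real.tan p.2 * dθ g p.1 p.2) p.2 :=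
      ht.mul (TangentialFamily.hasDerivAt_slice_strip hg hp)
    have h12 : HasDerivAt (fun θ => Real.tan θ * (f p.1 θ - g p.1 θ))
        ((1 / Real.cos p.2 ^ 2 * f p.1 p.2 + Real.tan p.2 * dθ f p.1 p.2) - (1 / Real.cos p.2 ^ 2 * g p.1 p.2 + Real.tan p.2 * dθ g p.1 p.2)) p.2 := by
      have := h1.sub h2
      refine this.congr_of_eventuallyEq (Eventually.of_forall fun θ => ?_)
      simp only [Pi.sub_apply]; ring
    show deriv (fun θ => Real.tan θ * (f p.1 θ - g p.1 θ)) p.2 = deriv (fun θ => Real.tan θ * f p.1 θ) p.2 - deriv (fun θ => Real.tan θ * g p.1 θ) p.2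
    rw [h12.deriv, h1.deriv, h2.deriv]
  unfold ellipticOp
  rw [hdzdz, hdz p hp, hdθdθ, htan]
  ring

/-- **`∂_θθ(f − g) = ∂_θθf − ∂_θθg` on the strip** for `f, g ∈ C^∞(strip)`. [folklore] -/
theorem dθ_dθ_sub_strip {f g : ℝ → ℝ → ℝ} (hf : ContDiffOn ℝ ∞ (uncurry f) strip) (hg : ContDiffOn ℝ ∞ (uncurry g) strip)
    {p : ℝ × ℝ} (hp : p ∈ strip) :
    dθ (dθ fun R θ => f R θ - g R θ) p.1 p.2 = dθ (dθ f) p.1 p.2 - dθ (dθ g) p.1 p.2 := by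
  have hdθ : ∀ q ∈ strip, dθ (fun R θ => f R θ - g R θ) q.1 q.2 = dθ f q.1 q.2 - dθ g q.1 q.2 := by
    intro q hq
    exact ((TangentialFamily.hasDerivAt_slice_strip hf hq).sub (TangentialFamily.hasDerivAt_slice_strip hg hq)).deriv
  rw [eqOn_dθ isOpen_strip (g := fun R θ => dθ f R θ - dθ g R θ) hdθ hp]
  exact ((TangentialFamily.hasDerivAt_slice_strip (contDiffOn_dθ_strip hf) hp).sub (TangentialFamily.hasDerivAt_slice_strip (contDiffOn_dθ_strip hg) hp)).deriv

/-! ### The modified datum -/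

/-- **The modified datum** `F̂ = F − (5/4)(K,F)_θ·sin 2θ·κ(θ)`. [cite: Elgindi2021, §7.5 (p. 24 of arXiv:1904.04795): "if we define G by … then Ψ̂ will enjoy all the bounds"] -/
def Fhat (F : ℝ → ℝ → ℝ) : ℝ → ℝ → ℝ := fun R θ => F R θ - 5 / 4 * kMoment F R * (Real.sin (2 * θ) * kappaAng θ)

namespace NiceDatum

variable {α : ℝ} {F : ℝ → ℝ → ℝ} (hF : NiceDatum F)
include hF

/-- `F̂` is smooth. [folklore] -/
theorem contDiff_Fhat (n : ℕ) : ContDiff ℝ n (uncurry (Fhat F)) := by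
  have h1 : ContDiff ℝ n (uncurry F) := hF.smooth n
  have h2 : ContDiff ℝ n (fun p : ℝ × ℝ => kMoment F p.1) := (contDiff_infty.1 hF.contDiff_kM n).comp contDiff_fst
  have h3 : ContDiff ℝ n (fun p : ℝ × ℝ => Real.sin (2 * p.2) * kappaAng p.2) :=
    ((Real.contDiff_sin.comp (contDiff_const.mul contDiff_snd)).mul ((contDiff_kappaAng (n := n)).comp contDiff_snd))
  have e : uncurry (Fhat F) = fun p : ℝ × ℝ => uncurry F p - 5 / 4 * kMoment F p.1 * (Real.sin (2 * p.2) * kappaAng p.2) := by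
    funext p; rfl
  rw [e]
  exact h1.sub ((contDiff_const.mul h2).mul h3)

/-- `F̂` has compact support inside `R > 0`. [folklore] -/
theorem hasCompactSupport_Fhat : HasCompactSupport (uncurry (Fhat F)) ∧ ∀ p ∈ tsupport (uncurry (Fhat F)), 0 < p.1 := by
  obtain ⟨a, b, ha, hab, hka, hkb⟩ := hF.kMoment_support
  obtain ⟨a', b', ha', -, hF0⟩ := exists_radial_bounds' hF.supp hF.sub
  -- support of the correction term: `[a,b] × tsupport κ`
  have hcorr : HasCompactSupport (fun p : ℝ × ℝ => 5 / 4 * kMoment F p.1 * (Real.sin (2 * p.2) * kappaAng p.2)) := by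
    refine HasCompactSupport.of_support_subset_isCompact ((isCompact_Icc (a := a) (b := b)).prod hasCompactSupport_kappaAng.isCompact) fun p hp => ?_
    simp only [mem_support, ne_eq, mul_eq_zero, not_or] at hp
    refine ⟨⟨?_, ?_⟩, subset_closure hp.2.2⟩
    · by_contra h; exact hp.1.2 (hka p.1 (not_le.1 h))
    · by_contra h; exact hp.1.2 (hkb p.1 (not_le.1 h))
  have e : uncurry (Fhat F) = fun p : ℝ × ℝ => uncurry F p - 5 / 4 * kMoment F p.1 * (Real.sin (2 * p.2) * kappaAng p.2) := by funext p; rfl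
  refine ⟨by rw [e]; exact hF.supp.sub hcorr, fun p hp => ?_⟩
  -- on `R < min a a'` the function vanishes identically near `p`
  by_contra hneg
  simp only [not_lt] at hneg
  have hm : 0 < min a a' := lt_min ha ha'
  have hev : uncurry (Fhat F) =ᶠ[𝓝 p] 0 := by
    have hopen : IsOpen {q : ℝ × ℝ | q.1 < min a a'} := isOpen_lt continuous_fst continuous_const
    filter_upwards [hopen.mem_nhds (show p.1 < min a a' from hneg.trans_lt hm)] with q hq
    have hq1 : q.1 < a := lt_of_lt_of_le hq (min_le_left _ _)
    have hq2 : q.1 < a' := lt_of_lt_of_le hq (min_le_right _ _)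
    have hF0q : F q.1 q.2 = 0 := by
      by_contra h; exact (not_le.2 hq2) (hF0 q.1 q.2 h).1
    show Fhat F q.1 q.2 = 0
    simp only [Fhat, hF0q, hka q.1 hq1]; ring
  exact (notMem_tsupport_iff_eventuallyEq.2 hev) hp

/-- **`F̂ ⊥ K`**: `∫∫ F̂·n(R)K(θ) = 0` for every continuous compactly supported `n`. [folklore] -/
theorem Fhat_orth {n : ℝ → ℝ} (hn : Continuous n) :
    ∫ p in strip, Fhat F p.1 p.2 * (n p.1 * kernelK p.2) = 0 := by
  have hc : Continuous (uncurry (Fhat F)) := (hF.contDiff_Fhat 0).continuous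
  rw [integral_strip_mul_radial_kernelK hc hF.hasCompactSupport_Fhat.1 hn]
  refine setIntegral_eq_zero_of_forall_eq_zero fun R hR => ?_
  -- `kMoment F̂ R = kMoment F R − (5/4) kMoment F R · (4/5) = 0`
  have e : kMoment (Fhat F) R = 0 := by
    rw [kMoment_def]
    have e1 : ∀ θ ∈ Ioo (0:ℝ) (π / 2), Fhat F R θ * kernelK θ = F R θ * kernelK θ - 5 / 4 * kMoment F R * (Real.sin (2 * θ) * kernelK θ) := by
      intro θ hθ
      simp only [Fhat]
      rw [kappaAng_eq_one (by linarith [hθ.1, Real.pi_pos]) (by linarith [hθ.2, Real.pi_pos])]; ring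
    rw [setIntegral_congr_fun measurableSet_Ioo e1]
    have i1 : IntegrableOn (fun θ => F R θ * kernelK θ) (Ioo 0 (π / 2)) :=
      ((((hF.smooth 0).continuous.comp (Continuous.prodMk_right R)).mul continuous_kernelK).integrableOn_Icc).mono_set Ioo_subset_Icc_self
    have i2 : IntegrableOn (fun θ => 5 / 4 * kMoment F R * (Real.sin (2 * θ) * kernelK θ)) (Ioo 0 (π / 2)) :=
      ((continuous_const.mul ((Real.continuous_sin.comp (continuous_const.mul continuous_id)).mul continuous_kernelK)).integrableOn_Icc).mono_set Ioo_subset_Icc_self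
    rw [integral_sub i1 i2, MeasureTheory.integral_const_mul, integral_sin2_mul_kernelK, ← kMoment_def]; ring
  rw [e, mul_zero]

end NiceDatum

/-! ### Algebra of the radial energies -/

/-- `A_j(c·g) = c²A_j(g)`. [folklore] -/
theorem radialEnergy_const_mul (c : ℝ) (g : ℝ → ℝ) (j : ℕ) : radialEnergy j (fun R => c * g R) = ENNReal.ofReal (c ^ 2) * radialEnergy j g := by
  unfold radialEnergy
  rw [iterate_Dz₁_const_mul', ← lintegral_const_mul' _ _ ENNReal.ofReal_ne_top]
  refine lintegral_congr fun R => ?_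
  rw [← ENNReal.ofReal_mul (sq_nonneg c)]
  congr 1; simp only; ring

/-- Additivity of `Dz₁`-iterates on `(0,∞)` for `Cⁿ` functions. [folklore] -/
theorem iterate_Dz₁_add_Ioi {g₁ g₂ : ℝ → ℝ} {N : ℕ} (h₁ : ContDiffOn ℝ N g₁ (Ioi 0)) (h₂ : ContDiffOn ℝ N g₂ (Ioi 0)) {l : ℕ} (hl : l ≤ N) :
    EqOn (Dz₁^[l] fun R => g₁ R + g₂ R) (fun R => (Dz₁^[l] g₁) R + (Dz₁^[l] g₂) R) (Ioi 0) := by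
  induction l generalizing g₁ g₂ N with
  | zero => intro R _; rfl
  | succ l ih =>
    intro R hR
    have hN1 : 1 ≤ N := by omega
    have e1 : EqOn (Dz₁ fun R => g₁ R + g₂ R) (fun R => Dz₁ g₁ R + Dz₁ g₂ R) (Ioi 0) := by
      intro r hr
      have hN0 : ((N : ℕ) : WithTop ℕ∞) ≠ 0 := by exact_mod_cast (by omega : N ≠ 0)
      have d1 : DifferentiableAt ℝ g₁ r := (h₁.differentiableOn hN0).differentiableAt (Ioi_mem_nhds hr)
      have d2 : DifferentiableAt ℝ g₂ r := (h₂.differentiableOn hN0).differentiableAt (Ioi_mem_nhds hr)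
      have h12 : HasDerivAt (fun R => g₁ R + g₂ R) (deriv g₁ r + deriv g₂ r) r := d1.hasDerivAt.add d2.hasDerivAt
      show r * deriv (fun R => g₁ R + g₂ R) r = r * deriv g₁ r + r * deriv g₂ r
      rw [h12.deriv]; ring
    rw [Function.iterate_succ_apply, iterate_Dz₁_congr_Ioi e1 l hR, Function.iterate_succ_apply, Function.iterate_succ_apply]
    obtain ⟨N', rfl⟩ : ∃ N', N = N' + 1 := ⟨N - 1, by omega⟩
    exact ih (contDiffOn_Dz₁_Ioi (by exact_mod_cast h₁)) (contDiffOn_Dz₁_Ioi (by exact_mod_cast h₂)) (by omega) hR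

/-- `A_j(g₁ + g₂) ≤ 2A_j(g₁) + 2A_j(g₂)` for `C^j(0,∞)` functions. [folklore] -/
theorem radialEnergy_add_le {g₁ g₂ : ℝ → ℝ} {j : ℕ} (h₁ : ContDiffOn ℝ j g₁ (Ioi 0)) (h₂ : ContDiffOn ℝ j g₂ (Ioi 0)) :
    radialEnergy j (fun R => g₁ R + g₂ R) ≤ 2 * radialEnergy j g₁ + 2 * radialEnergy j g₂ := by
  unfold radialEnergy
  have hm : ∀ {g : ℝ → ℝ}, ContDiffOn ℝ j g (Ioi 0) → AEMeasurable (fun R => ENNReal.ofReal (radialWeight R ^ 2 * (Dz₁^[j] g) R ^ 2)) (volume.restrict (Ioi 0)) := by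
    intro g hg
    have h1 : ContinuousOn (fun R : ℝ => radialWeight R ^ 2) (Ioi 0) := by
      unfold radialWeight
      exact ContinuousOn.pow (ContinuousOn.div (by fun_prop) (by fun_prop) fun R hR => pow_ne_zero 2 (ne_of_gt hR)) 2
    have h2 : ContinuousOn (Dz₁^[j] g) (Ioi 0) := (contDiffOn_iterate_Dz₁_Ioi (N := j) hg (l := j) (m := 0) (by omega)).continuousOn
    exact ((h1.mul (h2.pow 2)).aemeasurable measurableSet_Ioi).ennreal_ofReal
  rw [← lintegral_const_mul' _ _ (by norm_num), ← lintegral_const_mul' _ _ (by norm_num), ← lintegral_add_left' ((hm h₁).const_mul _)]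
  refine setLIntegral_mono' measurableSet_Ioi fun R hR => ?_
  rw [iterate_Dz₁_add_Ioi h₁ h₂ le_rfl hR]
  rw [← ENNReal.ofReal_ofNat 2, ← ENNReal.ofReal_mul (by norm_num), ← ENNReal.ofReal_mul (by norm_num), ← ENNReal.ofReal_add (by positivity) (by positivity)]
  refine ENNReal.ofReal_le_ofReal ?_
  have hw : 0 ≤ radialWeight R ^ 2 := sq_nonneg _
  nlinarith [mul_nonneg hw (sq_nonneg ((Dz₁^[j] g₁) R - (Dz₁^[j] g₂) R))]

namespace NiceDatum

variable {α : ℝ} {F : ℝ → ℝ → ℝ} (hF : NiceDatum F)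
include hF

/-- **`A_j(Ḡ) ≤ A_j(kMoment F)/324`** (`0 < α ≤ 1`): the `1/α` in front of `Ḡ` against the `O(α)` Hardy constant. [cite: Elgindi2021, §7.5 (p. 24 of arXiv:1904.04795): "while Ḡ is preceded by 1/α, we still have a good bound for it"] -/
theorem radialEnergy_Gbar_le (hα : 0 < α) (hα1 : α ≤ 1) (j : ℕ) : radialEnergy j (Gbar α F) ≤ ENNReal.ofReal (1 / 324) * radialEnergy j (kMoment F) := by
  obtain ⟨a, b, ha, hab, hka, hkb⟩ := hF.kMoment_support
  have hp : 1 / 2 < 5 / α := by rw [lt_div_iff₀ hα]; linarith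
  have e : Gbar α F = fun R => -(1 / (4 * α)) * radAvg (5 / α) (kMoment F) R := rfl
  rw [e, radialEnergy_const_mul]
  have h := radialEnergy_radAvg_le hF.contDiff_kM ha hab hka hkb hp j
  calc ENNReal.ofReal ((-(1 / (4 * α))) ^ 2) * radialEnergy j (radAvg (5 / α) (kMoment F))
      ≤ ENNReal.ofReal ((-(1 / (4 * α))) ^ 2) * (ENNReal.ofReal ((2 / (2 * (5 / α) - 1)) ^ 2) * radialEnergy j (kMoment F)) := mul_le_mul_right h _
    _ = ENNReal.ofReal ((-(1 / (4 * α))) ^ 2 * (2 / (2 * (5 / α) - 1)) ^ 2) * radialEnergy j (kMoment F) := by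
        rw [← mul_assoc, ← ENNReal.ofReal_mul (sq_nonneg _)]
    _ ≤ ENNReal.ofReal (1 / 324) * radialEnergy j (kMoment F) := by
        refine mul_le_mul_left (ENNReal.ofReal_le_ofReal ?_) _
        have h10 : 2 * (5 / α) - 1 = (10 - α) / α := by field_simp; ring
        rw [h10, show (-(1 / (4 * α))) ^ 2 * (2 / ((10 - α) / α)) ^ 2 = 1 / (4 * (10 - α) ^ 2) by field_simp; ring]
        rw [div_le_div_iff₀ (by nlinarith) (by norm_num)]
        nlinarith

/-! ### Tensors on the strip -/

omit hF in
/-- A radial function `Cⁿ` on `(0,∞)` for all `n` gives a strip-smooth tensor with `sin 2θ`. [folklore] -/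
theorem contDiffOn_tensor_sin2 {g : ℝ → ℝ} (hg : ∀ n : ℕ, ContDiffOn ℝ n g (Ioi 0)) : ContDiffOn ℝ ∞ (uncurry (tensor g sin2)) strip := by
  refine contDiffOn_infty.2 fun n => ?_
  have h1 : ContDiffOn ℝ n (fun p : ℝ × ℝ => g p.1) strip := (hg n).comp contDiffOn_fst fun p hp => hp.1
  have h2 : ContDiffOn ℝ n (fun p : ℝ × ℝ => sin2 p.2) strip := ((Real.contDiff_sin.comp (contDiff_const.mul contDiff_id)).comp contDiff_snd).contDiffOn
  exact (h1.mul h2).congr fun p _ => rfl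

/-- The `𝓗⁴` functional of `kMoment F ⊗ sin 2θ`. [folklore] -/
theorem eHk_tensor_kM_le {K : ℝ} (hK : ∀ (α : ℝ), 0 < α → α ≤ 1 → ∀ (g : ℝ → ℝ), ContDiffOn ℝ 4 g (Ioi 0) →
      eHkNormSq α 4 (tensor g sin2) ≤ ENNReal.ofReal K * ∑ j ∈ range 5, radialEnergy j g) (hα : 0 < α) (hα1 : α ≤ 1) :
    eHkNormSq α 4 (tensor (kMoment F) sin2) ≤ ENNReal.ofReal K * ∑ j ∈ range 5, radialEnergy j (kMoment F) :=
  hK α hα hα1 _ (contDiff_infty.1 hF.contDiff_kM 4).contDiffOn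

/-- The `𝓗⁴` functional of `Ḡ ⊗ sin 2θ`. [folklore] -/
theorem eHk_tensor_Gbar_le {K : ℝ} (hK : ∀ (α : ℝ), 0 < α → α ≤ 1 → ∀ (g : ℝ → ℝ), ContDiffOn ℝ 4 g (Ioi 0) →
      eHkNormSq α 4 (tensor g sin2) ≤ ENNReal.ofReal K * ∑ j ∈ range 5, radialEnergy j g) (hα : 0 < α) (hα1 : α ≤ 1) :
    eHkNormSq α 4 (tensor (Gbar α F) sin2) ≤ ENNReal.ofReal K * ∑ j ∈ range 5, radialEnergy j (kMoment F) := by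
  refine (hK α hα hα1 _ (hF.contDiffOn_Gbar 4)).trans (mul_le_mul_right ?_ _)
  calc ∑ j ∈ range 5, radialEnergy j (Gbar α F) ≤ ∑ j ∈ range 5, ENNReal.ofReal (1 / 324) * radialEnergy j (kMoment F) :=
        sum_le_sum fun j _ => hF.radialEnergy_Gbar_le hα hα1 j
    _ ≤ ∑ j ∈ range 5, radialEnergy j (kMoment F) := sum_le_sum fun j _ => by
        calc ENNReal.ofReal (1 / 324) * radialEnergy j (kMoment F) ≤ 1 * radialEnergy j (kMoment F) :=
              mul_le_mul_left (by rw [← ENNReal.ofReal_one]; exact ENNReal.ofReal_le_ofReal (by norm_num)) _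
          _ = radialEnergy j (kMoment F) := one_mul _

/-- The `𝓗⁴` functional of `((5/4)kMoment F + 25Ḡ) ⊗ sin 2θ`. [folklore] -/
theorem eHk_tensor_u_le {K : ℝ} (hK : ∀ (α : ℝ), 0 < α → α ≤ 1 → ∀ (g : ℝ → ℝ), ContDiffOn ℝ 4 g (Ioi 0) →
      eHkNormSq α 4 (tensor g sin2) ≤ ENNReal.ofReal K * ∑ j ∈ range 5, radialEnergy j g) (hα : 0 < α) (hα1 : α ≤ 1) :
    eHkNormSq α 4 (tensor (fun R => 5 / 4 * kMoment F R + 25 * Gbar α F R) sin2) ≤ ENNReal.ofReal K * (8 * ∑ j ∈ range 5, radialEnergy j (kMoment F)) := by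
  have hu : ContDiffOn ℝ 4 (fun R => 5 / 4 * kMoment F R + 25 * Gbar α F R) (Ioi 0) :=
    (contDiffOn_const.mul (contDiff_infty.1 hF.contDiff_kM 4).contDiffOn).add (contDiffOn_const.mul (hF.contDiffOn_Gbar 4))
  refine (hK α hα hα1 _ hu).trans (mul_le_mul_right ?_ _)
  rw [mul_sum]
  refine sum_le_sum fun j hj => ?_
  have hj' : j ≤ 4 := Nat.lt_succ_iff.1 (mem_range.1 hj)
  have h1 : ContDiffOn ℝ j (fun R => 5 / 4 * kMoment F R) (Ioi 0) := contDiffOn_const.mul (contDiff_infty.1 hF.contDiff_kM j).contDiffOn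
  have h2 : ContDiffOn ℝ j (fun R => 25 * Gbar α F R) (Ioi 0) := contDiffOn_const.mul (hF.contDiffOn_Gbar j)
  have hG := hF.radialEnergy_Gbar_le hα hα1 j
  calc radialEnergy j (fun R => 5 / 4 * kMoment F R + 25 * Gbar α F R)
      ≤ 2 * radialEnergy j (fun R => 5 / 4 * kMoment F R) + 2 * radialEnergy j (fun R => 25 * Gbar α F R) := radialEnergy_add_le h1 h2
    _ = 2 * (ENNReal.ofReal ((5 / 4) ^ 2) * radialEnergy j (kMoment F)) + 2 * (ENNReal.ofReal (25 ^ 2) * radialEnergy j (Gbar α F)) := by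
        rw [radialEnergy_const_mul, radialEnergy_const_mul]
    _ ≤ 2 * (ENNReal.ofReal ((5 / 4) ^ 2) * radialEnergy j (kMoment F)) + 2 * (ENNReal.ofReal (25 ^ 2) * (ENNReal.ofReal (1 / 324) * radialEnergy j (kMoment F))) := by gcongr
    _ = ENNReal.ofReal (2 * (5 / 4) ^ 2 + 2 * 25 ^ 2 * (1 / 324)) * radialEnergy j (kMoment F) := by
        rw [ENNReal.ofReal_add (by positivity) (by positivity), ENNReal.ofReal_mul (by norm_num), ENNReal.ofReal_mul (by positivity),
          ENNReal.ofReal_mul (by norm_num), ENNReal.ofReal_ofNat]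
        ring
    _ ≤ 8 * radialEnergy j (kMoment F) := by
        refine mul_le_mul_left ?_ _
        rw [← ENNReal.ofReal_ofNat 8]; exact ENNReal.ofReal_le_ofReal (by norm_num)

/-- `Σ_{j≤4} A_j(kMoment F) ≤ 5|F|²_{𝓗⁴}`. [folklore] -/
theorem sum_radialEnergy_kM_le (α : ℝ) : ∑ j ∈ range 5, radialEnergy j (kMoment F) ≤ 5 * eHkNormSq α 4 F := by
  refine (sum_radialEnergy_kMoment_le (hF.smooth 4) hF.supp α).trans ?_
  calc ENNReal.ofReal (9 * π / 32) * (5 * eHkNormSq α 4 F) ≤ 1 * (5 * eHkNormSq α 4 F) := by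
        refine mul_le_mul_left ?_ _
        rw [← ENNReal.ofReal_one]; exact ENNReal.ofReal_le_ofReal (by nlinarith [Real.pi_lt_d2])
    _ = 5 * eHkNormSq α 4 F := one_mul _

/-- **`|F̂|²_{𝓗⁴} ≤ 2|F|²_{𝓗⁴} + 4K·Σ A_j(kMoment F)`.** [folklore] -/
theorem eHk_Fhat_le {K : ℝ} (hK : ∀ (α : ℝ), 0 < α → α ≤ 1 → ∀ (g : ℝ → ℝ), ContDiffOn ℝ 4 g (Ioi 0) →
      eHkNormSq α 4 (tensor g sin2) ≤ ENNReal.ofReal K * ∑ j ∈ range 5, radialEnergy j g) (hα : 0 < α) (hα1 : α ≤ 1) :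
    eHkNormSq α 4 (Fhat F) ≤ 2 * eHkNormSq α 4 F + 4 * (ENNReal.ofReal K * ∑ j ∈ range 5, radialEnergy j (kMoment F)) := by
  have e : ∀ p ∈ strip, Fhat F p.1 p.2 = (F + (-(5 / 4) : ℝ) • tensor (kMoment F) sin2) p.1 p.2 := by
    intro p hp
    simp only [Fhat, Pi.add_apply, Pi.smul_apply, smul_eq_mul, tensor_apply, sin2]
    rw [kappaAng_eq_one (by linarith [hp.2.1, Real.pi_pos]) (by linarith [hp.2.2, Real.pi_pos])]; ring
  rw [eHkNormSq_congr_strip α 4 e]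
  have hf4 : ContDiffOn ℝ 4 (uncurry F) strip := (hF.smooth 4).contDiffOn
  have ht4 : ContDiffOn ℝ 4 (uncurry ((-(5 / 4) : ℝ) • tensor (kMoment F) sin2)) strip := by
    have := (contDiffOn_tensor_sin2 (g := kMoment F) fun n => (contDiff_infty.1 hF.contDiff_kM n).contDiffOn).of_le (WithTop.coe_le_coe.2 le_top : (4 : WithTop ℕ∞) ≤ ((⊤ : ℕ∞) : WithTop ℕ∞))
    exact (this.const_smul (-(5 / 4) : ℝ)).congr fun p _ => rfl
  refine (eHkNormSq_add_le hf4 ht4).trans ?_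
  rw [eHkNormSq_smul]
  have hn : (‖(-(5 / 4) : ℝ)‖ₑ ^ 2 : ℝ≥0∞) ≤ 2 := by
    rw [Real.enorm_eq_ofReal_abs, ← ENNReal.ofReal_pow (abs_nonneg _), ← ENNReal.ofReal_ofNat 2]
    exact ENNReal.ofReal_le_ofReal (by norm_num)
  calc 2 * eHkNormSq α 4 F + 2 * (‖(-(5 / 4) : ℝ)‖ₑ ^ 2 * eHkNormSq α 4 (tensor (kMoment F) sin2))
      ≤ 2 * eHkNormSq α 4 F + 2 * (2 * (ENNReal.ofReal K * ∑ j ∈ range 5, radialEnergy j (kMoment F))) :=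
        add_le_add le_rfl (mul_le_mul_right (mul_le_mul' hn (hF.eHk_tensor_kM_le hK hα hα1)) _)
    _ = 2 * eHkNormSq α 4 F + 4 * (ENNReal.ofReal K * ∑ j ∈ range 5, radialEnergy j (kMoment F)) := by ring

/-! ### The solution `Ψ = Ψ̂ − G ⊗ sin 2θ` -/

/-- **`LΨ = F` on the strip** for `Ψ = Ψ̂ − G ⊗ sin 2θ` when `LΨ̂ = F̂`. [cite: Elgindi2021, §7.5 (p. 24 of arXiv:1904.04795)] -/
theorem solution_eq (hα : 0 < α) {Ψh : ℝ → ℝ → ℝ} (hΨh : ContDiffOn ℝ ∞ (uncurry Ψh) strip)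
    (heq : ∀ p ∈ strip, ellipticOp α Ψh p.1 p.2 = Fhat F p.1 p.2) {p : ℝ × ℝ} (hp : p ∈ strip) :
    ellipticOp α (Ψh - tensor (Gcor α F) sin2) p.1 p.2 = F p.1 p.2 := by
  have hG : ContDiffOn ℝ ∞ (uncurry (tensor (Gcor α F) sin2)) strip := contDiffOn_tensor_sin2 hF.contDiffOn_Gcor
  have e : Ψh - tensor (Gcor α F) sin2 = fun R θ => Ψh R θ - tensor (Gcor α F) sin2 R θ := rfl
  rw [e, ellipticOp_sub_strip α hΨh hG hp, heq p hp, ellipticOp_tensor_sin2 α (hF.contDiffOn_Gcor 2) hp, hF.corrector_ode hα hp.1]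
  simp only [Fhat]
  rw [kappaAng_eq_one (by linarith [hp.2.1, Real.pi_pos]) (by linarith [hp.2.2, Real.pi_pos])]; ring

/-- `Ψ − (4α)⁻¹L₁₂(F) sin 2θ = Ψ̂ − Ḡ ⊗ sin 2θ` (everywhere). [folklore] -/
theorem removeL12_eq (α : ℝ) (Ψh : ℝ → ℝ → ℝ) :
    (fun R θ => (Ψh - tensor (Gcor α F) sin2) R θ - 1 / (4 * α) * L12 F R * Real.sin (2 * θ)) = Ψh - tensor (Gbar α F) sin2 := by
  have := hF
  funext R θ
  simp only [Pi.sub_apply, tensor_apply, sin2, Gcor, Gstar]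
  ring

/-- `∂_θθ(Ḡ ⊗ sin 2θ) = (−4) • (Ḡ ⊗ sin 2θ)`. [folklore] -/
theorem dθ_dθ_tensor_sin2 (g : ℝ → ℝ) : dθ (dθ (tensor g sin2)) = (-4 : ℝ) • tensor g sin2 := by
  have := hF
  rw [dθ_tensor, dθ_tensor, deriv_deriv_sin2]
  funext R θ; simp only [tensor_apply, Pi.smul_apply, smul_eq_mul, sin2]; ring

end NiceDatum

/-! ### Theorem 2 at `𝓗⁴` -/

/-- The constant `K` of the tensor estimate `|g ⊗ sin 2θ|²_{𝓗⁴} ≤ K·Σ_j radialEnergy j g`. [folklore] -/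
def thmTwoK : ℝ := Classical.choose eHkNormSq_tensor_sin2_le

/-- The defining property of `thmTwoK`. [folklore] -/
theorem thmTwoK_spec : 0 ≤ thmTwoK ∧ ∀ (α : ℝ), 0 < α → α ≤ 1 → ∀ (g : ℝ → ℝ), ContDiffOn ℝ 4 g (Ioi 0) →
    eHkNormSq α 4 (tensor g sin2) ≤ ENNReal.ofReal thmTwoK * ∑ j ∈ range 5, radialEnergy j g :=
  Classical.choose_spec eHkNormSq_tensor_sin2_le

/-- **The constant of Theorem 2 at `𝓗⁴`.** [folklore] -/
def thmTwoC : ℝ≥0∞ := 72 * aprioriC + 5 * ((144 * aprioriC + 98) * ENNReal.ofReal thmTwoK)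

/-- `thmTwoC < ∞`. [folklore] -/
theorem thmTwoC_ne_top : thmTwoC ≠ ⊤ := by
  have hA := aprioriC_ne_top
  exact ENNReal.add_ne_top.2 ⟨ENNReal.mul_ne_top (by norm_num) hA,
    ENNReal.mul_ne_top (by norm_num) (ENNReal.mul_ne_top (ENNReal.add_ne_top.2 ⟨ENNReal.mul_ne_top (by norm_num) hA, by norm_num⟩) ENNReal.ofReal_ne_top)⟩

/-- **The solution of Theorem 2** built from a smooth representative `Ψ̂` of the weak solution for the
modified datum `F̂`: `Ψ = Ψ̂ − G ⊗ sin 2θ`. [cite: Elgindi2021, §7.5 (p. 24 of arXiv:1904.04795)] -/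
def thmTwoSol (α : ℝ) (F : ℝ → ℝ → ℝ) (Ψh : ℝ × ℝ → ℝ) : ℝ → ℝ → ℝ := (fun R θ => Ψh (R, θ)) - tensor (Gcor α F) sin2

/-- **Theorem 2 at `𝓗⁴` for a given solution datum**: for `NiceDatum F`, `0 < α ≤ 1/4` and any solution
data `(U, Ψ̂)` of the modified problem `LΨ̂ = F̂`, the function `Ψ = Ψ̂ − G ⊗ sin 2θ` is smooth on the
strip, solves `LΨ = F` there, and
`|∂_θθ(Ψ − (4α)⁻¹L₁₂(F) sin 2θ)|²_{𝓗⁴} + |α²D_R²Ψ|²_{𝓗⁴} + |α²D_RΨ|²_{𝓗⁴} ≤ thmTwoC·|F|²_{𝓗⁴}`. [cite: Elgindi2021, §7.5 Theorem 2 (p. 24 of arXiv:1904.04795)] -/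
theorem theoremTwo_solData {α : ℝ} (hα : 0 < α) (hα4 : α ≤ 1 / 4) {F : ℝ → ℝ → ℝ} (hF : NiceDatum F)
    {U : ℕ → E4} {Ψr : ℝ × ℝ → ℝ} (hSD : SolData α (Fhat F) U Ψr) :
    ContDiffOn ℝ ∞ (uncurry (thmTwoSol α F Ψr)) strip ∧ (∀ p ∈ strip, ellipticOp α (thmTwoSol α F Ψr) p.1 p.2 = F p.1 p.2) ∧
      eHkNormSq α 4 (dθ (dθ fun R θ => thmTwoSol α F Ψr R θ - 1 / (4 * α) * L12 F R * Real.sin (2 * θ))) +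
        eHkNormSq α 4 ((α ^ 2) • (Dz^[2] (thmTwoSol α F Ψr))) + eHkNormSq α 4 ((α ^ 2) • Dz (thmTwoSol α F Ψr)) ≤ thmTwoC * eHkNormSq α 4 F := by
  obtain ⟨hK0, hK⟩ := thmTwoK_spec
  set K := thmTwoK
  have hα1 : α ≤ 1 := hα4.trans (by norm_num)
  -- the solution of the modified problem
  set Ψh : ℝ → ℝ → ℝ := fun R θ => Ψr (R, θ) with hΨh
  have hfam : TangentialFamily α (Fhat F) Ψh := (tangentialFamily hSD.pos hSD.le1 hSD.fn hSD.fs hSD.forth hSD.sol hSD.smooth hSD.ae)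
  have heq : ∀ p ∈ strip, ellipticOp α Ψh p.1 p.2 = Fhat F p.1 p.2 := fun p hp => by
    have := (tangentialFamily hSD.pos hSD.le1 hSD.fn hSD.fs hSD.forth hSD.sol hSD.smooth hSD.ae).eqn 0 p hp; simpa using this
  have hlhs : lhsA α Ψh ≤ 6 * aprioriC * eHkNormSq α 4 (Fhat F) := hSD.apriori_solution
  set Ψ : ℝ → ℝ → ℝ := Ψh - tensor (Gcor α F) sin2 with hΨdef
  have eΨ : thmTwoSol α F Ψr = Ψ := rfl
  rw [eΨ]
  have hGs : ContDiffOn ℝ ∞ (uncurry (tensor (Gcor α F) sin2)) strip := NiceDatum.contDiffOn_tensor_sin2 hF.contDiffOn_Gcor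
  have hGbs : ContDiffOn ℝ ∞ (uncurry (tensor (Gbar α F) sin2)) strip := NiceDatum.contDiffOn_tensor_sin2 hF.contDiffOn_Gbar
  have hΨs : ContDiffOn ℝ ∞ (uncurry Ψ) strip := (hfam.smooth.sub hGs).congr fun p _ => rfl
  refine ⟨hΨs, fun p hp => hF.solution_eq hα hfam.smooth heq hp, ?_⟩
  -- notation
  set Q := eHkNormSq α 4 F
  set S := ∑ j ∈ range 5, radialEnergy j (kMoment F)
  set K' := ENNReal.ofReal K
  set L := lhsA α Ψh
  have hS : S ≤ 5 * Q := hF.sum_radialEnergy_kM_le α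
  have hGb : eHkNormSq α 4 (tensor (Gbar α F) sin2) ≤ K' * S := hF.eHk_tensor_Gbar_le hK hα hα1
  have hFhat : eHkNormSq α 4 (Fhat F) ≤ 2 * Q + 4 * (K' * S) := hF.eHk_Fhat_le hK hα hα1
  have hL : L ≤ 6 * aprioriC * (2 * Q + 4 * (K' * S)) := hlhs.trans (mul_le_mul_right hFhat _)
  have h4 : (4 : WithTop ℕ∞) ≤ ((⊤ : ℕ∞) : WithTop ℕ∞) := WithTop.coe_le_coe.2 le_top
  have hsmul_le : ∀ (c : ℝ) (g : ℝ → ℝ → ℝ), |c| ≤ 1 → eHkNormSq α 4 (c • g) ≤ eHkNormSq α 4 g := by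
    intro c g hc
    rw [eHkNormSq_smul]
    calc (‖c‖ₑ ^ 2 : ℝ≥0∞) * eHkNormSq α 4 g ≤ 1 * eHkNormSq α 4 g := by
          refine mul_le_mul_left ?_ _
          rw [Real.enorm_eq_ofReal_abs, ← ENNReal.ofReal_pow (abs_nonneg _), ← ENNReal.ofReal_one]
          exact ENNReal.ofReal_le_ofReal (by nlinarith [abs_nonneg c])
      _ = eHkNormSq α 4 g := one_mul _
  -- piece 1: `∂_θθ`
  have T1 : eHkNormSq α 4 (dθ (dθ fun R θ => Ψ R θ - 1 / (4 * α) * L12 F R * Real.sin (2 * θ))) ≤ 2 * eHkNormSq α 4 (dθ (dθ Ψh)) + 32 * (K' * S) := by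
    rw [hΨdef, hF.removeL12_eq α Ψh]
    have e1 : ∀ p ∈ strip, dθ (dθ (Ψh - tensor (Gbar α F) sin2)) p.1 p.2 = (dθ (dθ Ψh) + (-1 : ℝ) • dθ (dθ (tensor (Gbar α F) sin2))) p.1 p.2 := by
      intro p hp
      have h := dθ_dθ_sub_strip hfam.smooth hGbs hp
      simp only [Pi.add_apply, Pi.smul_apply, smul_eq_mul]
      rw [show dθ (dθ Ψh) p.1 p.2 + -1 * dθ (dθ (tensor (Gbar α F) sin2)) p.1 p.2 = dθ (dθ Ψh) p.1 p.2 - dθ (dθ (tensor (Gbar α F) sin2)) p.1 p.2 by ring, ← h]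
      rfl
    rw [eHkNormSq_congr_strip α 4 e1]
    have c1 : ContDiffOn ℝ 4 (uncurry (dθ (dθ Ψh))) strip := (contDiffOn_dθ_strip (contDiffOn_dθ_strip hfam.smooth)).of_le h4
    have c2 : ContDiffOn ℝ 4 (uncurry ((-1 : ℝ) • dθ (dθ (tensor (Gbar α F) sin2)))) strip := by
      have := ((contDiffOn_dθ_strip (contDiffOn_dθ_strip hGbs)).of_le h4).const_smul (-1 : ℝ)
      exact this.congr fun p _ => rfl
    refine (eHkNormSq_add_le c1 c2).trans ?_
    have h16 : eHkNormSq α 4 ((-1 : ℝ) • dθ (dθ (tensor (Gbar α F) sin2))) ≤ 16 * (K' * S) := by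
      refine (hsmul_le _ _ (by norm_num)).trans ?_
      rw [hF.dθ_dθ_tensor_sin2, eHkNormSq_smul]
      have : (‖(-4 : ℝ)‖ₑ ^ 2 : ℝ≥0∞) = 16 := by
        rw [Real.enorm_eq_ofReal_abs, ← ENNReal.ofReal_pow (abs_nonneg _)]; norm_num
      rw [this]; exact mul_le_mul_right hGb _
    calc 2 * eHkNormSq α 4 (dθ (dθ Ψh)) + 2 * eHkNormSq α 4 ((-1 : ℝ) • dθ (dθ (tensor (Gbar α F) sin2)))
        ≤ 2 * eHkNormSq α 4 (dθ (dθ Ψh)) + 2 * (16 * (K' * S)) := by gcongr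
      _ = 2 * eHkNormSq α 4 (dθ (dθ Ψh)) + 32 * (K' * S) := by ring
  -- piece 2: `α²D_R²`
  have T2 : eHkNormSq α 4 ((α ^ 2) • (Dz^[2] Ψ)) ≤ 2 * eHkNormSq α 4 ((α ^ 2) • (Dz^[2] Ψh)) + 16 * (K' * S) := by
    set u : ℝ → ℝ := fun R => 5 / 4 * kMoment F R + 25 * Gbar α F R with hu
    have e1 : ∀ p ∈ strip, ((α ^ 2) • (Dz^[2] Ψ)) p.1 p.2 = ((α ^ 2) • (Dz^[2] Ψh) + (-1 : ℝ) • tensor u sin2) p.1 p.2 := by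
      intro p hp
      have h := iterate_Dθ_Dz_sub (i := 0) (j := 2) (hfam.smooth.of_le h4) (hGs.of_le h4) (by norm_num) p hp
      simp only [Function.iterate_zero, id_eq] at h
      simp only [Pi.smul_apply, Pi.add_apply, smul_eq_mul, hΨdef]
      rw [h, iterate_Dz_tensor]
      simp only [tensor_apply, Function.iterate_succ_apply', Function.iterate_zero, id_eq]
      have hD := hF.Dz₁_Dz₁_Gcor hα hp.1
      have hu1 : u p.1 = α ^ 2 * Dz₁ (Dz₁ (Gcor α F)) p.1 := by rw [hD, hu]; field_simp
      rw [hu1]; ring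
    rw [eHkNormSq_congr_strip α 4 e1]
    have c1 : ContDiffOn ℝ 4 (uncurry ((α ^ 2) • (Dz^[2] Ψh))) strip := by
      have := ((hfam.smooth_iterate 2).of_le h4).const_smul (α ^ 2)
      exact this.congr fun p _ => rfl
    have hut : ContDiffOn ℝ ∞ (uncurry (tensor u sin2)) strip := NiceDatum.contDiffOn_tensor_sin2 fun n =>
      (contDiffOn_const.mul (contDiff_infty.1 hF.contDiff_kM n).contDiffOn).add (contDiffOn_const.mul (hF.contDiffOn_Gbar n))
    have c2 : ContDiffOn ℝ 4 (uncurry ((-1 : ℝ) • tensor u sin2)) strip := by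
      have := (hut.of_le h4).const_smul (-1 : ℝ)
      exact this.congr fun p _ => rfl
    refine (eHkNormSq_add_le c1 c2).trans ?_
    have h8 : eHkNormSq α 4 ((-1 : ℝ) • tensor u sin2) ≤ K' * (8 * S) := (hsmul_le _ _ (by norm_num)).trans (hF.eHk_tensor_u_le hK hα hα1)
    calc 2 * eHkNormSq α 4 ((α ^ 2) • (Dz^[2] Ψh)) + 2 * eHkNormSq α 4 ((-1 : ℝ) • tensor u sin2)
        ≤ 2 * eHkNormSq α 4 ((α ^ 2) • (Dz^[2] Ψh)) + 2 * (K' * (8 * S)) := by gcongr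
      _ = 2 * eHkNormSq α 4 ((α ^ 2) • (Dz^[2] Ψh)) + 16 * (K' * S) := by ring
  -- piece 3: `α²D_R`
  have T3 : eHkNormSq α 4 ((α ^ 2) • Dz Ψ) ≤ 2 * eHkNormSq α 4 (α • Dz Ψh) + 50 * (K' * S) := by
    have e1 : ∀ p ∈ strip, ((α ^ 2) • Dz Ψ) p.1 p.2 = (α • (α • Dz Ψh) + (5 * α) • tensor (Gbar α F) sin2) p.1 p.2 := by
      intro p hp
      have h := iterate_Dθ_Dz_sub (i := 0) (j := 1) (hfam.smooth.of_le h4) (hGs.of_le h4) (by norm_num) p hp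
      simp only [Function.iterate_zero, id_eq, Function.iterate_one] at h
      simp only [Pi.smul_apply, Pi.add_apply, smul_eq_mul, hΨdef]
      rw [h, show Dz (tensor (Gcor α F) sin2) = tensor (Dz₁ (Gcor α F)) sin2 from Dz_tensor _ _]
      simp only [tensor_apply]
      rw [hF.Dz₁_Gcor hα hp.1]
      field_simp
      ring
    rw [eHkNormSq_congr_strip α 4 e1]
    have c1 : ContDiffOn ℝ 4 (uncurry (α • (α • Dz Ψh))) strip := by
      have := (((hfam.smooth_iterate 1).of_le h4).const_smul α).const_smul α
      exact this.congr fun p _ => rfl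
    have c2 : ContDiffOn ℝ 4 (uncurry ((5 * α) • tensor (Gbar α F) sin2)) strip := by
      have := (hGbs.of_le h4).const_smul (5 * α)
      exact this.congr fun p _ => rfl
    refine (eHkNormSq_add_le c1 c2).trans ?_
    have hA : eHkNormSq α 4 (α • (α • Dz Ψh)) ≤ eHkNormSq α 4 (α • Dz Ψh) := hsmul_le _ _ (by rw [abs_of_pos hα]; exact hα1)
    have hB : eHkNormSq α 4 ((5 * α) • tensor (Gbar α F) sin2) ≤ 25 * (K' * S) := by
      rw [eHkNormSq_smul]
      have : (‖(5 * α : ℝ)‖ₑ ^ 2 : ℝ≥0∞) ≤ 25 := by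
        rw [Real.enorm_eq_ofReal_abs, ← ENNReal.ofReal_pow (abs_nonneg _), ← ENNReal.ofReal_ofNat 25]
        refine ENNReal.ofReal_le_ofReal ?_
        rw [abs_of_pos (by positivity)]; nlinarith
      exact mul_le_mul' this hGb
    calc 2 * eHkNormSq α 4 (α • (α • Dz Ψh)) + 2 * eHkNormSq α 4 ((5 * α) • tensor (Gbar α F) sin2)
        ≤ 2 * eHkNormSq α 4 (α • Dz Ψh) + 2 * (25 * (K' * S)) := by gcongr
      _ = 2 * eHkNormSq α 4 (α • Dz Ψh) + 50 * (K' * S) := by ring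
  -- assembling
  have hsum : eHkNormSq α 4 (dθ (dθ fun R θ => Ψ R θ - 1 / (4 * α) * L12 F R * Real.sin (2 * θ))) +
      eHkNormSq α 4 ((α ^ 2) • (Dz^[2] Ψ)) + eHkNormSq α 4 ((α ^ 2) • Dz Ψ) ≤ 2 * L + 98 * (K' * S) := by
    calc _ ≤ (2 * eHkNormSq α 4 (dθ (dθ Ψh)) + 32 * (K' * S)) + (2 * eHkNormSq α 4 ((α ^ 2) • (Dz^[2] Ψh)) + 16 * (K' * S)) +
          (2 * eHkNormSq α 4 (α • Dz Ψh) + 50 * (K' * S)) := add_le_add (add_le_add T1 T2) T3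
      _ = 2 * L + 98 * (K' * S) := by simp only [L, lhsA]; ring
  calc _ ≤ 2 * L + 98 * (K' * S) := hsum
    _ ≤ 2 * (6 * aprioriC * (2 * Q + 4 * (K' * S))) + 98 * (K' * S) := by gcongr
    _ = 24 * aprioriC * Q + (48 * aprioriC + 98) * (K' * S) := by ring
    _ ≤ 24 * aprioriC * Q + (48 * aprioriC + 98) * (K' * (5 * Q)) := by gcongr
    _ = (24 * aprioriC + 5 * ((48 * aprioriC + 98) * K')) * Q := by ring
    _ ≤ (72 * aprioriC + 5 * ((144 * aprioriC + 98) * ENNReal.ofReal K)) * Q := by gcongr <;> norm_num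
    _ = thmTwoC * Q := rfl

/-- **Theorem 2 (removing `L₁₂`) at `𝓗⁴` for smooth data supported in the open strip, `0 < α ≤ 1/4`**:
there is a universal constant `C` such that `LΨ = F` has a solution `Ψ ∈ C^∞(strip)` with
`|∂_θθ(Ψ − (4α)⁻¹L₁₂(F) sin 2θ)|²_{𝓗⁴} + |α²D_R²Ψ|²_{𝓗⁴} + |α²D_RΨ|²_{𝓗⁴} ≤ C|F|²_{𝓗⁴}`
(`α²R²∂_{RR} = α²(D_R² − D_R)`). [cite: Elgindi2021, §7.5 Theorem 2 (p. 24 of arXiv:1904.04795)] -/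
theorem theoremTwo : ∃ C : ℝ≥0∞, C ≠ ⊤ ∧ ∀ (α : ℝ), 0 < α → α ≤ 1 / 4 → ∀ (F : ℝ → ℝ → ℝ), NiceDatum F →
    ∃ Ψ : ℝ → ℝ → ℝ, ContDiffOn ℝ ∞ (uncurry Ψ) strip ∧ (∀ p ∈ strip, ellipticOp α Ψ p.1 p.2 = F p.1 p.2) ∧
      eHkNormSq α 4 (dθ (dθ fun R θ => Ψ R θ - 1 / (4 * α) * L12 F R * Real.sin (2 * θ))) +
        eHkNormSq α 4 ((α ^ 2) • (Dz^[2] Ψ)) + eHkNormSq α 4 ((α ^ 2) • Dz Ψ) ≤ C * eHkNormSq α 4 F := by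
  refine ⟨thmTwoC, thmTwoC_ne_top, fun α hα hα4 F hF => ?_⟩
  obtain ⟨U, Ψr, hSD⟩ := exists_solData hα hα4 (hF.contDiff_Fhat) hF.hasCompactSupport_Fhat.1 hF.hasCompactSupport_Fhat.2
    (fun n hn _ => hF.Fhat_orth hn)
  exact ⟨thmTwoSol α F Ψr, theoremTwo_solData hα hα4 hF hSD⟩

end Elgindi

end Literature.Analysis.FluidPDE
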